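/-
Copyright (c) 2026. Released under Apache 2.0 license.
-/
import Literature.NumberTheory.EllipticCurves.ModularCurveEtaProductsProofs

/-!
# The multiplier system of the Dedekind eta function (Petersson–Knopp formula)

Mathlib knows `η(τ + 1) = e^{πi/12} η(τ)` and `η(-1/τ) = (√i)⁻¹ √τ η(τ)`
(`ModularForm.eta_comp_eq_csqrt_I_inv`), and `ModularCurveEtaProductsProofs` deduced from these
the character of `η²` on all of `SL₂(ℤ)` in closed form. Here we prove the full
**transformation law of `η` itself** under every `γ = (a b; c d) ∈ SL₂(ℤ)`, with the multiplier
in Petersson's closed form via the Jacobi symbol (Knopp, *Modular functions in analytic number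
theory*, Ch. 4, Thm. 2): for `c > 0` (or `c = 0`, `d = 1`) and `τ ∈ ℍ`,

  `η(γτ) = v_η(γ) · √(cτ + d) · η(τ)`   (`eta_SL2_smul`), where
  `v_η(γ) = (d/c)   · exp(πi[(a + d)c - bd(c² - 1) - 3c]/12)`            if `c` is odd,
  `v_η(γ) = (c/|d|) · exp(πi[(a + d)c - bd(c² - 1) + 3d - 3 - 3cd]/12)`  if `c` is even

(`etaMultiplier`; `√` is the principal branch, which for `cτ + d ∈ ℍ ∪ ℝ_{>0}` is the branch
used by Knopp). Matrices with `c < 0`, or `c = 0` and `d < 0`, act like their negatives, so this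
covers all of `SL₂(ℤ)`; for `c > 0` and `d` odd both formulas are valid
(`etaMultiplier_of_odd_d`, the form used in Newman's `η`-quotient criterion), and `|v_η| = 1`
(`norm_etaMultiplier`).

## Proof

We follow Knopp's proof (loc. cit., §2 of Ch. 4): induction over words in the generators
`S`, `T`, here organised as `Subgroup.closure_induction_right` on the statement for the
normalised representative `posRep γ ∈ {±γ}` (`etaTransfAt_posRep`). The three steps are
`γ ↦ γT`, `γ ↦ γT⁻¹` (both from the arithmetic identity `v_η(γT) = e^{πi/12} v_η(γ)`,
`etaMultiplier_mul_T`, Knopp's case 1) and `γ ↦ γS` (Knopp's case 3), where the representative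
of `γS = (b, -a; d, -c)` is `γS` if `d > 0` and `-γS` if `d ≤ 0`; the corresponding branch
relations `√(-c/τ + d) √τ = √(dτ - c)` (`d > 0`) and `= i √(-dτ + c)` (`d ≤ 0`)
(`csqrt_mul_csqrt_of_pos`, `csqrt_mul_csqrt_of_nonpos`, Knopp's (2)) are proved by locating
the square roots in the first quadrant, and the arithmetic identities
`v_η(γS) = e^{-πi/4} v_η(γ)`, `v_η(-γS) = e^{πi/4} v_η(γ)` (`etaMultiplier_mul_S_of_pos`,
`etaMultiplier_mul_S_of_nonpos`). Each arithmetic identity splits into a Jacobi-symbol relation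
— periodicity, `(-c/d) = χ₄(d)(c/d)`, quadratic reciprocity with a signed numerator
(`jacobiSym_swap`, Knopp's Lemma 1 (g)) and the shift `(c/|c + d|) = ±(c/|d|)` for even `c`
(`jacobiSym_even_shift`, Knopp's case 1 (b)) — and a congruence modulo `24` between the
exponents, which is a finite check on residues modulo `8` and `3` (`etaMult_step_*`, `decide`).

## Main statements

* `eta_SL2_smul`: the transformation law with Petersson's multiplier (Knopp, Ch. 4, Thm. 2).
* `etaMultiplier_of_odd_d`: for `c > 0`, `d` odd the second formula holds too.
* `norm_etaMultiplier`: `|v_η(γ)| = 1`.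
* `etaMultiplier_mul_T`, `etaMultiplier_mul_S_of_pos`, `etaMultiplier_mul_S_of_nonpos`: the
  consistency of Petersson's formula with the generators.

## References

* M. I. Knopp, *Modular functions in analytic number theory*, Markham, Chicago 1970, Ch. 4,
  §§1–2 (Thm. 2 and its proof). [Knopp1970]
* H. Petersson, Über die arithmetischen Eigenschaften eines Systems multiplikativer
  Modulfunktionen von Primzahlstufe, Acta Math. 95 (1956) (the closed formula).
-/

noncomputable section

open UpperHalfPlane hiding I
open ModularForm Complex Matrix.SpecialLinearGroup
open scoped MatrixGroups Real ModularForm NumberTheorySymbols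

namespace Literature.NumberTheory.EllipticCurves.ModularForms

/-! ### Principal square roots of points of the upper half-plane -/

/-- `Re √z > 0` unless `z` is a non-positive real. [folklore] -/
theorem csqrt_re_pos {z : ℂ} (hz : 0 < z.re ∨ z.im ≠ 0) : 0 < (Complex.sqrt z).re := by
  rw [Complex.sqrt, Complex.cpow_inv_two_re]
  apply Real.sqrt_pos.mpr
  have h1 : |z.re| ≤ ‖z‖ := Complex.abs_re_le_norm z
  rcases hz with h | h
  · have : 0 ≤ ‖z‖ := norm_nonneg _
    have : -‖z‖ ≤ z.re := by linarith [neg_abs_le z.re]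
    positivity
  · have h2 : |z.re| < ‖z‖ := Complex.abs_re_lt_norm.mpr h
    have : -z.re ≤ |z.re| := neg_le_abs z.re
    linarith

/-- `Im √z > 0` when `Im z > 0`. [folklore] -/
theorem csqrt_im_pos {z : ℂ} (hz : 0 < z.im) : 0 < (Complex.sqrt z).im := by
  rw [Complex.sqrt, Complex.cpow_inv_two_im_eq_sqrt hz.le]
  apply Real.sqrt_pos.mpr
  have h2 : |z.re| < ‖z‖ := Complex.abs_re_lt_norm.mpr hz.ne'
  have : z.re ≤ |z.re| := le_abs_self z.re
  linarith

/-- `Im √z ≥ 0` when `Im z ≥ 0`. [folklore] -/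
theorem csqrt_im_nonneg {z : ℂ} (hz : 0 ≤ z.im) : 0 ≤ (Complex.sqrt z).im := by
  rw [Complex.sqrt, Complex.cpow_inv_two_im_eq_sqrt hz]
  exact Real.sqrt_nonneg _

/-- **Recognising the principal square root**: if `w² = z` where `z` lies in the upper
half-plane or on the positive real axis, and `w` lies in the upper half-plane or on the positive
real axis, then `w = √z`. [folklore] -/
theorem csqrt_eq_of_sq_eq {w z : ℂ} (hw : w ^ 2 = z) (hz : 0 < z.im ∨ (z.im = 0 ∧ 0 < z.re))
    (hW : 0 < w.im ∨ (w.im = 0 ∧ 0 < w.re)) : Complex.sqrt z = w := by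
  have hsq : Complex.sqrt z ^ 2 = w ^ 2 := by rw [csqrt_sq, hw]
  rcases sq_eq_sq_iff_eq_or_eq_neg.mp hsq with h | h
  · exact h
  · exfalso
    -- `√z = -w`: compare imaginary / real parts
    have hre : 0 < (Complex.sqrt z).re := by
      apply csqrt_re_pos
      rcases hz with hz | hz
      · exact Or.inr hz.ne'
      · exact Or.inl hz.2
    have him : 0 ≤ (Complex.sqrt z).im := by
      apply csqrt_im_nonneg
      rcases hz with hz | hz
      · exact hz.le
      · exact hz.1.ge
    rw [h] at hre him
    simp only [Complex.neg_re, Complex.neg_im] at hre him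
    rcases hW with hW | hW
    · linarith
    · linarith [hW.2]

/-- `√z` lies in the open first quadrant for `z ∈ ℍ`. [folklore] -/
theorem csqrt_mem_quadrant {z : ℂ} (hz : 0 < z.im) :
    0 < (Complex.sqrt z).re ∧ 0 < (Complex.sqrt z).im :=
  ⟨csqrt_re_pos (Or.inr hz.ne'), csqrt_im_pos hz⟩

/-- `√(x) = √x` (real square root) for `x > 0`: positive real part, zero imaginary part.
[folklore] -/
theorem csqrt_ofReal_pos {x : ℝ} (hx : 0 < x) :
    Complex.sqrt (x : ℂ) = (Real.sqrt x : ℂ) := by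
  rw [Complex.sqrt_of_nonneg (by exact_mod_cast hx.le)]
  simp

/-- The product of two points of the open first quadrant has positive imaginary part. [folklore] -/
theorem im_mul_pos_of_quadrant {u v : ℂ} (hu : 0 < u.re ∧ 0 < u.im) (hv : 0 < v.re ∧ 0 < v.im) :
    0 < (u * v).im := by
  rw [Complex.mul_im]
  nlinarith [hu.1, hu.2, hv.1, hv.2]

/-- **Branch lemma 1** (Knopp Ch. 4 (2), case `d > 0`): for `τ ∈ ℍ`, `c ≥ 0`, `d > 0`,
`√(-c/τ + d) · √τ = √(dτ - c)`. [folklore] -/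
theorem csqrt_mul_csqrt_of_pos (τ : ℍ) {c d : ℝ} (hc : 0 ≤ c) (hd : 0 < d) :
    Complex.sqrt (-c / (τ : ℂ) + d) * Complex.sqrt τ = Complex.sqrt (d * (τ : ℂ) - c) := by
  have hτ : (τ : ℂ) ≠ 0 := τ.ne_zero
  have hτim : 0 < (τ : ℂ).im := τ.2
  symm
  apply csqrt_eq_of_sq_eq
  · rw [mul_pow, csqrt_sq, csqrt_sq]
    field_simp
    ring
  · left
    simpa using mul_pos hd hτim
  · left
    -- `√τ` is in the open first quadrant; `√(-c/τ + d)` is in the first quadrant or positive real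
    have hv := csqrt_mem_quadrant hτim
    rcases hc.eq_or_lt with rfl | hc
    · have h0 : (-((0 : ℝ) : ℂ) / τ + d) = ((d : ℝ) : ℂ) := by push_cast; ring
      rw [h0, csqrt_ofReal_pos hd, Complex.mul_im, Complex.ofReal_re, Complex.ofReal_im, zero_mul,
        add_zero]
      exact mul_pos (Real.sqrt_pos.mpr hd) hv.2
    · have him : 0 < (-(c : ℂ) / τ + d).im := by
        rw [Complex.add_im, Complex.ofReal_im, add_zero, neg_div, Complex.neg_im,
          Complex.div_im]
        simp only [Complex.ofReal_re, Complex.ofReal_im, zero_mul, zero_div, zero_sub,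
          neg_neg]
        apply div_pos (mul_pos hc hτim)
        exact Complex.normSq_pos.mpr hτ
      exact im_mul_pos_of_quadrant (csqrt_mem_quadrant him) hv

/-- **Branch lemma 2** (Knopp Ch. 4 (2), case `d ≤ 0`): for `τ ∈ ℍ`, `c > 0`, `d ≤ 0`,
`√(-c/τ + d) · √τ = i · √(-dτ + c)`. [folklore] -/
theorem csqrt_mul_csqrt_of_nonpos (τ : ℍ) {c d : ℝ} (hc : 0 < c) (hd : d ≤ 0) :
    Complex.sqrt (-c / (τ : ℂ) + d) * Complex.sqrt τ = I * Complex.sqrt (-d * (τ : ℂ) + c) := by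
  have hτ : (τ : ℂ) ≠ 0 := τ.ne_zero
  have hτim : 0 < (τ : ℂ).im := τ.2
  set W := Complex.sqrt (-c / (τ : ℂ) + d) * Complex.sqrt τ with hWdef
  set s := Complex.sqrt (-d * (τ : ℂ) + c) with hsdef
  have hW2 : W ^ 2 = (I * s) ^ 2 := by
    rw [hWdef, hsdef, mul_pow, mul_pow, csqrt_sq, csqrt_sq, csqrt_sq, I_sq]
    field_simp
    ring
  -- `Im W > 0`
  have hv := csqrt_mem_quadrant hτim
  have him : 0 < (-(c : ℂ) / τ + d).im := by
    rw [Complex.add_im, Complex.ofReal_im, add_zero, neg_div, Complex.neg_im, Complex.div_im]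
    simp only [Complex.ofReal_re, Complex.ofReal_im, zero_mul, zero_div, zero_sub, neg_neg]
    exact div_pos (mul_pos hc hτim) (Complex.normSq_pos.mpr hτ)
  have hWim : 0 < W.im := im_mul_pos_of_quadrant (csqrt_mem_quadrant him) hv
  -- `Re s > 0`, so `Im (I s) > 0` and `Im (-(I s)) < 0`
  have hsre : 0 < s.re := by
    apply csqrt_re_pos
    rcases hd.eq_or_lt with rfl | hd
    · left; simp [hc]
    · right
      rw [Complex.add_im, Complex.ofReal_im, add_zero, Complex.mul_im]
      simp only [Complex.neg_re, Complex.ofReal_re, Complex.neg_im, Complex.ofReal_im, neg_zero,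
        zero_mul, add_zero]
      exact (mul_pos (neg_pos.mpr hd) hτim).ne'
  rcases sq_eq_sq_iff_eq_or_eq_neg.mp hW2 with h | h
  · exact h
  · exfalso
    have : W.im = -s.re := by rw [h]; simp
    linarith

/-- `(√i)⁻¹ = e^{-πi/4}`. [folklore] -/
theorem csqrt_I_inv : (Complex.sqrt I)⁻¹ = cexp (-(π * I / 4)) := by
  rw [sqrt_eq_exp I_ne_zero, Complex.log_I, ← Complex.exp_neg]
  congr 1
  ring

/-! ### Jacobi symbol lemmas -/

/-- The sign `ε(c, d) = -1` if `c ≡ 3` and `d ≡ 3 (mod 4)`, `+1` otherwise (the reciprocity sign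
`(-1)^{(c-1)(d-1)/4}` for odd positive `c, d`). [folklore] -/
def recipSign (c d : ℤ) : ℤ := if c % 4 = 3 ∧ d % 4 = 3 then -1 else 1

/-- `ε(c,d)² = 1`. [folklore] -/
theorem recipSign_mul_self (c d : ℤ) : recipSign c d * recipSign c d = 1 := by
  unfold recipSign; split_ifs <;> norm_num

/-- The reciprocity sign `(-1)^{(a-1)(b-1)/4}` for odd `a, b ∈ ℕ` is `ε(a, b)`. [folklore] -/
theorem neg_one_pow_div_two_mul_div_two {a b : ℕ} (ha : Odd a) (hb : Odd b) :
    ((-1 : ℤ) ^ (a / 2 * (b / 2))) = recipSign a b := by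
  unfold recipSign
  obtain ⟨k, rfl⟩ := ha
  obtain ⟨l, rfl⟩ := hb
  have h1 : (2 * k + 1) / 2 = k := by omega
  have h2 : (2 * l + 1) / 2 = l := by omega
  rw [h1, h2]
  rcases Nat.even_or_odd k with hk | hk
  · rw [(hk.mul_right l).neg_one_pow, if_neg]
    obtain ⟨m, rfl⟩ := hk
    push_cast
    omega
  · rcases Nat.even_or_odd l with hl | hl
    · rw [(hl.mul_left k).neg_one_pow, if_neg]
      obtain ⟨m, rfl⟩ := hl
      push_cast
      omega
    · rw [(hk.mul hl).neg_one_pow, if_pos]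
      obtain ⟨m, rfl⟩ := hk
      obtain ⟨n, rfl⟩ := hl
      push_cast
      omega

/-- `χ₄(n) = -1` iff `n ≡ 3 (mod 4)`, for odd `n ∈ ℕ`. [folklore] -/
theorem χ₄_nat_eq_of_odd {n : ℕ} (hn : Odd n) :
    ZMod.χ₄ (n : ZMod 4) = if n % 4 = 3 then -1 else 1 := by
  rw [ZMod.χ₄_nat_eq_if_mod_four]
  have : n % 2 = 1 := Nat.odd_iff.mp hn
  by_cases h3 : n % 4 = 3
  · rw [if_neg (by omega), if_neg (by omega), if_pos h3]
  · rw [if_neg (by omega), if_pos (by omega), if_neg h3]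

/-- **Reciprocity with a signed numerator**: for odd `c ∈ ℕ` and odd `d ∈ ℤ`,
`(d/c) = ε(c, d) (c/|d|)` (Knopp, Ch. 4, Lemma 1 (f), (g)). [folklore] -/
theorem jacobiSym_swap {c : ℕ} (hc : Odd c) {d : ℤ} (hd : Odd d) :
    J(d | c) = recipSign c d * J(c | d.natAbs) := by
  obtain ⟨m, rfl | rfl⟩ := Int.eq_nat_or_neg d
  · -- `d = m ≥ 0`
    have hm : Odd m := by exact_mod_cast hd
    rw [Int.natAbs_natCast, jacobiSym.quadratic_reciprocity hm hc,
      neg_one_pow_div_two_mul_div_two hm hc]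
    unfold recipSign
    congr 1
    apply if_congr _ rfl rfl
    omega
  · -- `d = -m < 0`
    have hm : Odd m := by
      rw [odd_neg] at hd
      exact_mod_cast hd
    have hm2 : m % 2 = 1 := Nat.odd_iff.mp hm
    rw [Int.natAbs_neg, Int.natAbs_natCast, jacobiSym.neg _ hc,
      jacobiSym.quadratic_reciprocity hm hc, neg_one_pow_div_two_mul_div_two hm hc,
      χ₄_nat_eq_of_odd hc, ← mul_assoc]
    congr 1
    unfold recipSign
    have hm4 : (m : ℤ) % 4 = 1 ∨ (m : ℤ) % 4 = 3 := by omega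
    have hc4 : (c : ℤ) % 4 = 1 ∨ (c : ℤ) % 4 = 3 := by
      have : (c : ℤ) % 2 = 1 := by exact_mod_cast Nat.odd_iff.mp hc
      omega
    have hneg : (-(m : ℤ)) % 4 = 4 - (m : ℤ) % 4 := by omega
    have hc4' : (c % 4 : ℕ) = ((c : ℤ) % 4 : ℤ) := by push_cast; rfl
    rcases hm4 with h | h <;> rcases hc4 with h' | h' <;>
      simp [h, h', hneg, show (c % 4 = 3) ↔ ((c : ℤ) % 4 = 3) by omega]

/-- `χ₈` is even: `χ₈(|d|) = χ₈(d)`. [folklore] -/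
theorem χ₈_natAbs (d : ℤ) : ZMod.χ₈ ((d.natAbs : ℕ) : ZMod 8) = ZMod.χ₈ (d : ZMod 8) := by
  have key : ∀ x : ZMod 8, ZMod.χ₈ (-x) = ZMod.χ₈ x := by decide
  obtain ⟨m, rfl | rfl⟩ := Int.eq_nat_or_neg d
  · simp
  · rw [Int.natAbs_neg, Int.natAbs_natCast, Int.cast_neg, Int.cast_natCast, key]

/-- **Even numerator**: for `c = 2^α c₁` with `c₁` odd and `d` odd,
`(c/|d|) = χ₈(d)^α ε(c₁, d) (d/c₁)`. [folklore] -/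
theorem jacobiSym_two_pow_mul {α c₁ : ℕ} (hc₁ : Odd c₁) {d : ℤ} (hd : Odd d) :
    J((2 ^ α * c₁ : ℕ) | d.natAbs) = ZMod.χ₈ (d : ZMod 8) ^ α * recipSign c₁ d * J(d | c₁) := by
  have hm : Odd d.natAbs := Int.natAbs_odd.mpr hd
  rw [Nat.cast_mul, Nat.cast_pow, jacobiSym.mul_left, jacobiSym.pow_left, Nat.cast_ofNat,
    jacobiSym.at_two hm, χ₈_natAbs, jacobiSym_swap hc₁ hd, mul_assoc, ← mul_assoc (recipSign _ _),
    recipSign_mul_self, one_mul]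

/-- For odd `x`, `χ₈(x)² = 1`. [folklore] -/
theorem χ₈_int_sq_of_odd {x : ℤ} (hx : Odd x) : ZMod.χ₈ (x : ZMod 8) ^ 2 = 1 := by
  rw [ZMod.χ₈_int_eq_if_mod_eight]
  have : x % 2 = 1 := Int.odd_iff.mp hx
  split_ifs <;> omega

/-- **Shift by an even numerator** (Knopp, Ch. 4, proof of Thm. 2, case 1 (b)): for even `c > 0`
and odd `d`, `(c/|d + c|) = ± (c/|d|)` with the sign `-1` iff `c ≡ 2 (mod 4)` and
`d ≡ 1 (mod 4)`. [folklore] -/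
theorem jacobiSym_even_shift {c : ℕ} (hc0 : c ≠ 0) (hc : Even c) {d : ℤ} (hd : Odd d) :
    J(c | (d + c).natAbs) = (if c % 4 = 2 ∧ d % 4 = 1 then -1 else 1) * J(c | d.natAbs) := by
  obtain ⟨α, c₁, hc₁, rfl⟩ := Nat.exists_eq_two_pow_mul_odd hc0
  have hce : Even ((2 ^ α * c₁ : ℕ) : ℤ) := by exact_mod_cast hc
  have hd' : Odd (d + (2 ^ α * c₁ : ℕ)) := Int.odd_add.mpr (iff_of_true hd hce)
  rw [jacobiSym_two_pow_mul hc₁ hd', jacobiSym_two_pow_mul hc₁ hd]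
  -- `((d + c) / c₁) = (d / c₁)`
  have hper : J(d + (2 ^ α * c₁ : ℕ) | c₁) = J(d | c₁) := by
    rw [jacobiSym.mod_left, Nat.cast_mul, Nat.cast_pow, Int.add_mul_emod_self_right,
      ← jacobiSym.mod_left]
  rw [hper]
  have hα : α ≠ 0 := by
    rintro rfl
    rw [pow_zero, one_mul] at hc
    exact (Nat.not_even_iff_odd.mpr hc₁) hc
  have hc₁2 : (c₁ : ℤ) % 2 = 1 := by exact_mod_cast Nat.odd_iff.mp hc₁
  have hd2 : d % 2 = 1 := Int.odd_iff.mp hd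
  rcases Nat.even_or_odd α with hαe | hαo
  · -- `α` even, so `α ≥ 2`, `χ₈^α = 1` and `4 ∣ c`
    have hα2 : 2 ≤ α := by obtain ⟨k, hk⟩ := hαe; omega
    have h4n : 2 ^ α * c₁ % 4 = 0 :=
      Nat.mod_eq_zero_of_dvd (dvd_mul_of_dvd_left
        (by rw [show (4 : ℕ) = 2 ^ 2 by norm_num]; exact pow_dvd_pow 2 hα2) _)
    have h4 : ((2 ^ α * c₁ : ℕ) : ℤ) % 4 = 0 := by exact_mod_cast h4n
    have hx : ∀ x : ℤ, Odd x → ZMod.χ₈ (x : ZMod 8) ^ α = 1 := by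
      intro x hx
      obtain ⟨k, rfl⟩ := hαe
      rw [← two_mul, pow_mul, χ₈_int_sq_of_odd hx, one_pow]
    rw [hx _ hd', hx _ hd, if_neg (by omega)]
    have hd4 : (d + (2 ^ α * c₁ : ℕ)) % 4 = d % 4 := by omega
    unfold recipSign
    rw [hd4]
    simp only [one_mul]
  · -- `α` odd: `χ₈^α = χ₈`
    have hx : ∀ x : ℤ, ZMod.χ₈ (x : ZMod 8) ^ α = ZMod.χ₈ (x : ZMod 8) := by
      intro x
      obtain ⟨k, rfl⟩ := hαo
      rw [pow_succ, pow_mul]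
      have : ZMod.χ₈ (x : ZMod 8) ^ 2 = 1 ∨ ZMod.χ₈ (x : ZMod 8) = 0 := by
        rw [ZMod.χ₈_int_eq_if_mod_eight]; split_ifs <;> norm_num
      rcases this with h | h
      · rw [h, one_pow, one_mul]
      · rw [h]; ring
    rw [hx, hx]
    rcases Nat.eq_zero_or_pos (α - 1) with h1 | h1
    · -- `α = 1`: `c = 2 c₁ ≡ 2 mod 4`
      have hα1 : α = 1 := by omega
      subst hα1
      have hc4 : (2 ^ 1 * c₁) % 4 = 2 := by omega
      rw [if_congr (and_congr_left fun _ ↦ iff_of_true hc4 trivial) rfl rfl]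
      -- reduce to residues of `c₁ mod 4` and `d mod 8`
      unfold recipSign
      rw [ZMod.χ₈_int_eq_if_mod_eight, ZMod.χ₈_int_eq_if_mod_eight]
      push_cast
      have hd8 : d % 8 = 1 ∨ d % 8 = 3 ∨ d % 8 = 5 ∨ d % 8 = 7 := by omega
      have hc₁4 : (c₁ : ℤ) % 4 = 1 ∨ (c₁ : ℤ) % 4 = 3 := by omega
      rcases hd8 with h | h | h | h <;> rcases hc₁4 with h' | h' <;>
        simp [h, h', show (d + 2 * c₁) % 2 = 1 by omega, hd2] <;> omega
    · -- `α ≥ 3`: `8 ∣ c`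
      have hα3 : 3 ≤ α := by obtain ⟨k, hk⟩ := hαo; omega
      have h8n : 2 ^ α * c₁ % 8 = 0 :=
        Nat.mod_eq_zero_of_dvd (dvd_mul_of_dvd_left
          (by rw [show (8 : ℕ) = 2 ^ 3 by norm_num]; exact pow_dvd_pow 2 hα3) _)
      have h4n : 2 ^ α * c₁ % 4 = 0 := by omega
      have h8 : ((2 ^ α * c₁ : ℕ) : ℤ) % 8 = 0 := by exact_mod_cast h8n
      rw [if_neg (by omega)]
      have hd8 : ((d + (2 ^ α * c₁ : ℕ) : ℤ) : ZMod 8) = (d : ZMod 8) := by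
        rw [ZMod.intCast_eq_intCast_iff']
        omega
      have hd4 : (d + (2 ^ α * c₁ : ℕ)) % 4 = d % 4 := by omega
      unfold recipSign
      rw [hd8, hd4]
      simp only [one_mul]

/-! ### The Petersson–Knopp exponents and their step congruences -/

/-- The first Petersson–Knopp exponent `(a + d)c - bd(c² - 1) - 3c` (used for `c` odd), over any
commutative ring so that it can be reduced modulo `8` and `3`. [folklore] -/
def etaP₁ {R : Type*} [CommRing R] (a b c d : R) : R := (a + d) * c - b * d * (c ^ 2 - 1) - 3 * c

/-- The second Petersson–Knopp exponent `(a + d)c - bd(c² - 1) + 3d - 3 - 3cd` (used for `c`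
even). [folklore] -/
def etaP₂ {R : Type*} [CommRing R] (a b c d : R) : R :=
  (a + d) * c - b * d * (c ^ 2 - 1) + 3 * d - 3 - 3 * c * d

/-- `etaP₁` commutes with the reduction maps `ℤ → ℤ/n`. [folklore] -/
theorem cast_etaP₁ (n : ℕ) (a b c d : ℤ) :
    ((etaP₁ a b c d : ℤ) : ZMod n) = etaP₁ (a : ZMod n) b c d := by
  unfold etaP₁; push_cast; ring

/-- `etaP₂` commutes with the reduction maps `ℤ → ℤ/n`. [folklore] -/
theorem cast_etaP₂ (n : ℕ) (a b c d : ℤ) :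
    ((etaP₂ a b c d : ℤ) : ZMod n) = etaP₂ (a : ZMod n) b c d := by
  unfold etaP₂; push_cast; ring

/-- `24 ∣ x` from `x ≡ 0 (mod 8)` and `x ≡ 0 (mod 3)`. [folklore] -/
theorem twentyfour_dvd_of_zmod {x : ℤ} (h8 : (x : ZMod 8) = 0) (h3 : (x : ZMod 3) = 0) :
    (24 : ℤ) ∣ x := by
  have h8' := (ZMod.intCast_zmod_eq_zero_iff_dvd x 8).mp h8
  have h3' := (ZMod.intCast_zmod_eq_zero_iff_dvd x 3).mp h3
  have := IsCoprime.mul_dvd (show IsCoprime ((8 : ℕ) : ℤ) ((3 : ℕ) : ℤ) by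
    norm_num [Int.isCoprime_iff_gcd_eq_one]) h8' h3'
  simpa using this

/-- Step congruence `T1` (mod `8`), a finite check. [folklore] -/
theorem etaMult_step_T1 : ∀ a b e f : ZMod 8, a * f - b * (2 * e + 1) = 1 →
    etaP₁ a (a + b) (2 * e + 1) ((2 * e + 1) + f) =
      etaP₁ a b (2 * e + 1) f + 1 := by
  decide

/-- Step congruence `T2` (mod `8`), a finite check. [folklore] -/
theorem etaMult_step_T2 : ∀ a b e f : ZMod 8, a * f - b * (4 * e) = 1 →
    etaP₂ a (a + b) (4 * e) ((4 * e) + f) =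
      etaP₂ a b (4 * e) f + 1 := by
  decide

/-- Step congruence `T3` (mod `8`), a finite check. [folklore] -/
theorem etaMult_step_T3 : ∀ a b e f : ZMod 8, a * (4 * f + 3) - b * (4 * e + 2) = 1 →
    etaP₂ a (a + b) (4 * e + 2) ((4 * e + 2) + (4 * f + 3)) =
      etaP₂ a b (4 * e + 2) (4 * f + 3) + 1 := by
  decide

/-- Step congruence `T4` (mod `8`), a finite check. [folklore] -/
theorem etaMult_step_T4 : ∀ a b e f : ZMod 8, a * (4 * f + 1) - b * (4 * e + 2) = 1 →
    etaP₂ a (a + b) (4 * e + 2) ((4 * e + 2) + (4 * f + 1)) =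
      etaP₂ a b (4 * e + 2) (4 * f + 1) + 13 := by
  decide

/-- Step congruence `S1` (mod `8`), a finite check. [folklore] -/
theorem etaMult_step_S1 : ∀ a b e f : ZMod 8, a * (4 * f + 3) - b * (4 * e + 1) = 1 →
    etaP₁ b (-a) (4 * f + 3) (-(4 * e + 1)) =
      etaP₁ a b (4 * e + 1) (4 * f + 3) + 9 := by
  decide

/-- Step congruence `S2` (mod `8`), a finite check. [folklore] -/
theorem etaMult_step_S2 : ∀ a b e f : ZMod 8, a * (2 * f + 1) - b * (4 * e + 3) = 1 →
    etaP₁ b (-a) (2 * f + 1) (-(4 * e + 3)) =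
      etaP₁ a b (4 * e + 3) (2 * f + 1) - 3 := by
  decide

/-- Step congruence `S3` (mod `8`), a finite check. [folklore] -/
theorem etaMult_step_S3 : ∀ a b e f : ZMod 8, a * (4 * f + 1) - b * (4 * e + 1) = 1 →
    etaP₁ b (-a) (4 * f + 1) (-(4 * e + 1)) =
      etaP₁ a b (4 * e + 1) (4 * f + 1) - 3 := by
  decide

/-- Step congruence `S4` (mod `8`), a finite check. [folklore] -/
theorem etaMult_step_S4 : ∀ a b e f : ZMod 8, a * (2 * f) - b * (2 * e + 1) = 1 →
    etaP₂ b (-a) (2 * f) (-(2 * e + 1)) =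
      etaP₁ a b (2 * e + 1) (2 * f) - 3 := by
  decide

/-- Step congruence `S5` (mod `8`), a finite check. [folklore] -/
theorem etaMult_step_S5 : ∀ a b e f : ZMod 8, a * (4 * f + 3) - b * (2 * e) = 1 →
    etaP₁ b (-a) (4 * f + 3) (-(2 * e)) =
      etaP₂ a b (2 * e) (4 * f + 3) + 9 := by
  decide

/-- Step congruence `S6` (mod `8`), a finite check. [folklore] -/
theorem etaMult_step_S6 : ∀ a b e f : ZMod 8, a * (4 * f + 1) - b * (2 * e) = 1 →
    etaP₁ b (-a) (4 * f + 1) (-(2 * e)) =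
      etaP₂ a b (2 * e) (4 * f + 1) - 3 := by
  decide

/-- Step congruence `M1` (mod `8`), a finite check. [folklore] -/
theorem etaMult_step_M1 : ∀ a b e f : ZMod 8, a * (4 * f + 3) - b * (4 * e + 3) = 1 →
    etaP₁ (-b) a (-(4 * f + 3)) (4 * e + 3) =
      etaP₁ a b (4 * e + 3) (4 * f + 3) + 15 := by
  decide

/-- Step congruence `M2` (mod `8`), a finite check. [folklore] -/
theorem etaMult_step_M2 : ∀ a b e f : ZMod 8, a * (2 * f + 1) - b * (4 * e + 1) = 1 →
    etaP₁ (-b) a (-(2 * f + 1)) (4 * e + 1) =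
      etaP₁ a b (4 * e + 1) (2 * f + 1) + 3 := by
  decide

/-- Step congruence `M3` (mod `8`), a finite check. [folklore] -/
theorem etaMult_step_M3 : ∀ a b e f : ZMod 8, a * (4 * f + 1) - b * (4 * e + 3) = 1 →
    etaP₁ (-b) a (-(4 * f + 1)) (4 * e + 3) =
      etaP₁ a b (4 * e + 3) (4 * f + 1) + 3 := by
  decide

/-- Step congruence `M4` (mod `8`), a finite check. [folklore] -/
theorem etaMult_step_M4 : ∀ a b e f : ZMod 8, a * (2 * f) - b * (4 * e + 3) = 1 →
    etaP₂ (-b) a (-(2 * f)) (4 * e + 3) =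
      etaP₁ a b (4 * e + 3) (2 * f) + 15 := by
  decide

/-- Step congruence `M5` (mod `8`), a finite check. [folklore] -/
theorem etaMult_step_M5 : ∀ a b e f : ZMod 8, a * (2 * f) - b * (4 * e + 1) = 1 →
    etaP₂ (-b) a (-(2 * f)) (4 * e + 1) =
      etaP₁ a b (4 * e + 1) (2 * f) + 3 := by
  decide

/-- Step congruence `M6` (mod `8`), a finite check. [folklore] -/
theorem etaMult_step_M6 : ∀ a b e f : ZMod 8, a * (2 * f + 1) - b * (2 * e) = 1 →
    etaP₁ (-b) a (-(2 * f + 1)) (2 * e) =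
      etaP₂ a b (2 * e) (2 * f + 1) + 3 := by
  decide

/-- Step congruence `T1m3` (mod `3`), a finite check. [folklore] -/
theorem etaMult_step_T1m3 : ∀ a b e f : ZMod 3, a * f - b * e = 1 →
    etaP₁ a (a + b) e (e + f) =
      etaP₁ a b e f + 1 := by
  decide

/-- Step congruence `T2m3` (mod `3`), a finite check. [folklore] -/
theorem etaMult_step_T2m3 : ∀ a b e f : ZMod 3, a * f - b * e = 1 →
    etaP₂ a (a + b) e (e + f) =
      etaP₂ a b e f + 1 := by
  decide

/-- Step congruence `S11m3` (mod `3`), a finite check. [folklore] -/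
theorem etaMult_step_S11m3 : ∀ a b e f : ZMod 3, a * f - b * e = 1 →
    etaP₁ b (-a) f (-e) =
      etaP₁ a b e f - 3 := by
  decide

/-- Step congruence `S21m3` (mod `3`), a finite check. [folklore] -/
theorem etaMult_step_S21m3 : ∀ a b e f : ZMod 3, a * f - b * e = 1 →
    etaP₂ b (-a) f (-e) =
      etaP₁ a b e f - 3 := by
  decide

/-- Step congruence `S12m3` (mod `3`), a finite check. [folklore] -/
theorem etaMult_step_S12m3 : ∀ a b e f : ZMod 3, a * f - b * e = 1 →
    etaP₁ b (-a) f (-e) =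
      etaP₂ a b e f - 3 := by
  decide

/-- Step congruence `M11m3` (mod `3`), a finite check. [folklore] -/
theorem etaMult_step_M11m3 : ∀ a b e f : ZMod 3, a * f - b * e = 1 →
    etaP₁ (-b) a (-f) e =
      etaP₁ a b e f + 3 := by
  decide

/-- Step congruence `M21m3` (mod `3`), a finite check. [folklore] -/
theorem etaMult_step_M21m3 : ∀ a b e f : ZMod 3, a * f - b * e = 1 →
    etaP₂ (-b) a (-f) e =
      etaP₁ a b e f + 3 := by
  decide

/-- Step congruence `M12m3` (mod `3`), a finite check. [folklore] -/
theorem etaMult_step_M12m3 : ∀ a b e f : ZMod 3, a * f - b * e = 1 →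
    etaP₁ (-b) a (-f) e =
      etaP₂ a b e f + 3 := by
  decide

/-! ### Roots of unity bookkeeping -/

/-- `e^{πi e'/12} = e^{πi e/12}` when `24 ∣ e' - e`. [folklore] -/
theorem cexp_pi_I_div_twelve_eq_of_dvd {e e' : ℤ} (h : (24 : ℤ) ∣ e' - e) :
    cexp (π * I / 12 * e') = cexp (π * I / 12 * e) := by
  obtain ⟨t, ht⟩ := h
  rw [show (e' : ℂ) = e + 24 * t by exact_mod_cast (by omega : e' = e + 24 * t), mul_add,
    Complex.exp_add, show (π * I / 12 * (24 * t) : ℂ) = t * (2 * π * I) by ring,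
    Complex.exp_int_mul_two_pi_mul_I, mul_one]

/-- `e^{πi·12/12} = -1`. [folklore] -/
theorem cexp_pi_I_div_twelve_mul_twelve : cexp (π * I / 12 * 12) = -1 := by
  rw [show (π * I / 12 * 12 : ℂ) = π * I by ring, Complex.exp_pi_mul_I]

/-- Combining a Jacobi-symbol identity without sign change and an exponent congruence.
[folklore] -/
theorem jac_cexp_of_eq {Jn Jo Pn Po k : ℤ} (hJ : Jn = Jo) (hP : (24 : ℤ) ∣ Pn - (Po + k)) :
    (Jn : ℂ) * cexp (π * I / 12 * Pn) =
      (Jo : ℂ) * cexp (π * I / 12 * Po) * cexp (π * I / 12 * k) := by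
  rw [hJ, cexp_pi_I_div_twelve_eq_of_dvd hP, Int.cast_add, mul_add, Complex.exp_add, mul_assoc]

/-- Combining a Jacobi-symbol identity with sign change and an exponent congruence shifted by
`12`. [folklore] -/
theorem jac_cexp_of_eq_neg {Jn Jo Pn Po k : ℤ} (hJ : Jn = -Jo)
    (hP : (24 : ℤ) ∣ Pn - (Po + k + 12)) :
    (Jn : ℂ) * cexp (π * I / 12 * Pn) =
      (Jo : ℂ) * cexp (π * I / 12 * Po) * cexp (π * I / 12 * k) := by
  rw [hJ, cexp_pi_I_div_twelve_eq_of_dvd hP, Int.cast_add, Int.cast_add, mul_add, mul_add,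
    Complex.exp_add, Complex.exp_add, Int.cast_ofNat, cexp_pi_I_div_twelve_mul_twelve]
  push_cast
  ring

/-! ### The Petersson–Knopp multiplier -/

/-- **The multiplier system of `η`** in Petersson's closed form (Knopp, Ch. 4, Thm. 2), for
matrices normalised to `c > 0` (or `c = 0`, `d = 1`):
`v_η(a b; c d) = (d/c) e^{πi[(a+d)c - bd(c²-1) - 3c]/12}` if `c` is odd and
`v_η(a b; c d) = (c/|d|) e^{πi[(a+d)c - bd(c²-1) + 3d - 3 - 3cd]/12}` if `c` is even, `(·/·)` the
Jacobi symbol. [cite: Knopp1970, Ch. 4, Thm. 2] -/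
def etaMultiplier (a b c d : ℤ) : ℂ :=
  if Odd c then (J(d | c.natAbs) : ℂ) * cexp (π * I / 12 * etaP₁ a b c d)
  else (J(c | d.natAbs) : ℂ) * cexp (π * I / 12 * etaP₂ a b c d)

/-- The odd-`c` branch. [folklore] -/
theorem etaMultiplier_of_odd {a b c d : ℤ} (hc : Odd c) :
    etaMultiplier a b c d = (J(d | c.natAbs) : ℂ) * cexp (π * I / 12 * etaP₁ a b c d) := by
  unfold etaMultiplier; rw [if_pos hc]

/-- The even-`c` branch. [folklore] -/
theorem etaMultiplier_of_even {a b c d : ℤ} (hc : Even c) :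
    etaMultiplier a b c d = (J(c | d.natAbs) : ℂ) * cexp (π * I / 12 * etaP₂ a b c d) := by
  unfold etaMultiplier; rw [if_neg (Int.not_odd_iff_even.mpr hc)]

/-- `v_η(1) = 1`. [folklore] -/
theorem etaMultiplier_one : etaMultiplier 1 0 0 1 = 1 := by
  rw [etaMultiplier_of_even (by decide)]
  simp [etaP₂]

/-- In `SL₂(ℤ)`, if `c` is even then `d` is odd. [folklore] -/
theorem odd_d_of_even_c {a b c d : ℤ} (hdet : a * d - b * c = 1) (hc : Even c) : Odd d := by
  by_contra h
  rw [Int.not_odd_iff_even] at h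
  have : Even (a * d - b * c) := (h.mul_left a).sub (hc.mul_left b)
  rw [hdet] at this
  exact Int.not_even_one this

/-- `3 = 0` in `ℤ/3`. [folklore] -/
theorem zmod3_three_eq_zero : (3 : ZMod 3) = 0 := by decide

/-! ### Step `γ ↦ γT` -/

/-- `J(d + c | c) = J(d | c)` for `c > 0`. [folklore] -/
theorem jacobiSym_add_self_left {c : ℤ} (hc : 0 < c) (d : ℤ) :
    J(c + d | c.natAbs) = J(d | c.natAbs) := by
  obtain ⟨n, rfl⟩ := Int.eq_ofNat_of_zero_le hc.le
  rw [Int.natAbs_natCast, jacobiSym.mod_left, Int.add_emod_left, ← jacobiSym.mod_left]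

/-- **Arithmetic of the step `γ ↦ γT`** (Knopp, Ch. 4, proof of Thm. 2, case 1): for
`ad - bc = 1` with `c > 0` or `(c, d) = (0, 1)`, `v_η(γT) = e^{πi/12} v_η(γ)`. [folklore] -/
theorem etaMultiplier_mul_T {a b c d : ℤ} (hdet : a * d - b * c = 1)
    (hpos : 0 < c ∨ (c = 0 ∧ d = 1)) :
    etaMultiplier a (a + b) c (c + d) = etaMultiplier a b c d * cexp (π * I / 12) := by
  have hk : cexp (π * I / 12) = cexp (π * I / 12 * (1 : ℤ)) := by push_cast; rw [mul_one]
  rw [hk]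
  rcases Int.even_or_odd c with hce | hco
  · -- `c` even, `d` odd; both sides in the even branch
    have hdo : Odd d := odd_d_of_even_c hdet hce
    rw [etaMultiplier_of_even hce, etaMultiplier_of_even hce]
    rcases hpos with hc | ⟨rfl, rfl⟩
    · -- `c > 0`
      obtain ⟨n, hn⟩ := Int.eq_ofNat_of_zero_le hc.le
      have hn0 : n ≠ 0 := by rintro rfl; simp at hn; omega
      have hne : Even n := by rw [hn] at hce; exact_mod_cast hce
      have hJ : J(c | (c + d).natAbs) =
          (if c % 4 = 2 ∧ d % 4 = 1 then -1 else 1) * J(c | d.natAbs) := by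
        rw [add_comm c d, hn]
        have := jacobiSym_even_shift hn0 hne hdo
        have h4 : ((n : ℤ) % 4 = 2) ↔ (n % 4 = 2) := by omega
        simp only [h4]
        exact this
      by_cases hcond : c % 4 = 2 ∧ d % 4 = 1
      · rw [if_pos hcond, neg_one_mul] at hJ
        apply jac_cexp_of_eq_neg hJ
        obtain ⟨e, rfl⟩ : ∃ e, c = 4 * e + 2 := ⟨c / 4, by omega⟩
        obtain ⟨f, rfl⟩ : ∃ f, d = 4 * f + 1 := ⟨d / 4, by omega⟩
        refine twentyfour_dvd_of_zmod ?_ ?_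
        · have h := etaMult_step_T4 (a : ZMod 8) b e f
            (by exact_mod_cast congrArg (Int.cast : ℤ → ZMod 8) hdet)
          simp only [etaP₂] at h ⊢
          push_cast
          linear_combination h
        · have h := etaMult_step_T2m3 (a : ZMod 3) b (4 * e + 2) (4 * f + 1)
            (by exact_mod_cast congrArg (Int.cast : ℤ → ZMod 3) hdet)
          simp only [etaP₂] at h ⊢
          push_cast at h ⊢
          linear_combination h - 4 * zmod3_three_eq_zero
      · rw [if_neg hcond, one_mul] at hJ
        apply jac_cexp_of_eq hJ
        refine twentyfour_dvd_of_zmod ?_ ?_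
        · -- two residue sub-cases: `c ≡ 0 (mod 4)` or `c ≡ 2, d ≡ 3 (mod 4)`
          have hc2 : c % 2 = 0 := Int.even_iff.mp hce
          have hd2 : d % 2 = 1 := Int.odd_iff.mp hdo
          by_cases hc4 : c % 4 = 0
          · obtain ⟨e, rfl⟩ : ∃ e, c = 4 * e := ⟨c / 4, by omega⟩
            have h := etaMult_step_T2 (a : ZMod 8) b e d
              (by exact_mod_cast congrArg (Int.cast : ℤ → ZMod 8) hdet)
            simp only [etaP₂] at h ⊢
            push_cast
            linear_combination h
          · obtain ⟨e, rfl⟩ : ∃ e, c = 4 * e + 2 := ⟨c / 4, by omega⟩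
            obtain ⟨f, rfl⟩ : ∃ f, d = 4 * f + 3 := ⟨d / 4, by omega⟩
            have h := etaMult_step_T3 (a : ZMod 8) b e f
              (by exact_mod_cast congrArg (Int.cast : ℤ → ZMod 8) hdet)
            simp only [etaP₂] at h ⊢
            push_cast
            linear_combination h
        · have h := etaMult_step_T2m3 (a : ZMod 3) b c d
            (by exact_mod_cast congrArg (Int.cast : ℤ → ZMod 3) hdet)
          simp only [etaP₂] at h ⊢
          push_cast at h ⊢
          linear_combination h
    · -- `c = 0`, `d = 1`, hence `a = 1`
      have ha : a = 1 := by linarith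
      subst ha
      apply jac_cexp_of_eq (by simp)
      exact ⟨0, by simp [etaP₂]; ring⟩
  · -- `c` odd; both sides in the odd branch
    rw [etaMultiplier_of_odd hco, etaMultiplier_of_odd hco]
    have hc : 0 < c := by
      rcases hpos with h | ⟨rfl, -⟩
      · exact h
      · exact absurd hco (by decide)
    apply jac_cexp_of_eq (jacobiSym_add_self_left hc d)
    obtain ⟨e, rfl⟩ := hco
    refine twentyfour_dvd_of_zmod ?_ ?_
    · have h := etaMult_step_T1 (a : ZMod 8) b e d
        (by exact_mod_cast congrArg (Int.cast : ℤ → ZMod 8) hdet)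
      simp only [etaP₁] at h ⊢
      push_cast
      linear_combination h
    · have h := etaMult_step_T1m3 (a : ZMod 3) b (2 * e + 1) d
        (by exact_mod_cast congrArg (Int.cast : ℤ → ZMod 3) hdet)
      simp only [etaP₁] at h ⊢
      push_cast at h ⊢
      linear_combination h

/-! ### Step `γ ↦ γS` -/

/-- Reduction of the determinant condition modulo `n`. [folklore] -/
theorem zmod_det (n : ℕ) {a b c d : ℤ} (hdet : a * d - b * c = 1) :
    (a : ZMod n) * (d : ZMod n) - (b : ZMod n) * (c : ZMod n) = 1 := by
  exact_mod_cast congrArg (Int.cast : ℤ → ZMod n) hdet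

/-- `J(-c | |d|) = χ₄(|d|) J(c | |d|)` for odd `d`. [folklore] -/
theorem jacobiSym_neg_left_natAbs (c : ℤ) {d : ℤ} (hd : Odd d) :
    J(-c | d.natAbs) = ZMod.χ₄ ((d.natAbs : ℕ) : ZMod 4) * J(c | d.natAbs) :=
  jacobiSym.neg _ (Int.natAbs_odd.mpr hd)

/-- `χ₄(|d|)` for odd `d > 0`: `-1` iff `d ≡ 3 (mod 4)`. [folklore] -/
theorem χ₄_natAbs_of_pos {d : ℤ} (hd : Odd d) (hpos : 0 < d) :
    ZMod.χ₄ ((d.natAbs : ℕ) : ZMod 4) = if d % 4 = 3 then -1 else 1 := by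
  rw [χ₄_nat_eq_of_odd (Int.natAbs_odd.mpr hd)]
  have : (d.natAbs % 4 = 3) ↔ (d % 4 = 3) := by omega
  simp only [this]

/-- `(c/|d|) = ε(c, d) (d/c)` for odd `c > 0` and odd `d` (reciprocity, Knopp Lemma 1 (g)).
[folklore] -/
theorem jacobiSym_eq_recipSign_mul {c d : ℤ} (hc0 : 0 < c) (hc : Odd c) (hd : Odd d) :
    J(c | d.natAbs) = recipSign c d * J(d | c.natAbs) := by
  obtain ⟨n, rfl⟩ := Int.eq_ofNat_of_zero_le hc0.le
  have hn : Odd n := by exact_mod_cast hc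
  rw [Int.natAbs_natCast, jacobiSym_swap hn hd, ← mul_assoc, recipSign_mul_self, one_mul]

/-- **Arithmetic of the step `γ ↦ γS`, case `d > 0`** (Knopp, Ch. 4, proof of Thm. 2, case 3):
for `ad - bc = 1` with `c ≥ 0` and `d > 0`, `v_η(γS) = e^{-πi/4} v_η(γ)` where
`γS = (b, -a; d, -c)`. [folklore] -/
theorem etaMultiplier_mul_S_of_pos {a b c d : ℤ} (hdet : a * d - b * c = 1) (hc : 0 ≤ c)
    (hd : 0 < d) :
    etaMultiplier b (-a) d (-c) = etaMultiplier a b c d * cexp (-(π * I / 4)) := by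
  have hk : cexp (-(π * I / 4)) = cexp (π * I / 12 * (-3 : ℤ)) := by push_cast; congr 1; ring
  rw [hk]
  rcases Int.even_or_odd c with hce | hco
  · -- `c` even (`c ≥ 0`), `d` odd: old even branch, new odd branch
    have hdo : Odd d := odd_d_of_even_c hdet hce
    rw [etaMultiplier_of_even hce, etaMultiplier_of_odd hdo, jacobiSym_neg_left_natAbs _ hdo,
      χ₄_natAbs_of_pos hdo hd]
    obtain ⟨e, rfl⟩ := hce
    by_cases hd3 : d % 4 = 3
    · rw [if_pos hd3]
      apply jac_cexp_of_eq_neg (by ring)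
      obtain ⟨f, rfl⟩ : ∃ f, d = 4 * f + 3 := ⟨d / 4, by omega⟩
      refine twentyfour_dvd_of_zmod ?_ ?_
      · have h := etaMult_step_S5 (a : ZMod 8) b e f (by
            have h' := zmod_det 8 hdet; push_cast at h'; linear_combination h')
        simp only [etaP₁, etaP₂] at h ⊢
        push_cast
        linear_combination h
      · have h := etaMult_step_S12m3 (a : ZMod 3) b (e + e) (4 * f + 3) (by
            have h' := zmod_det 3 hdet; push_cast at h'; linear_combination h')
        simp only [etaP₁, etaP₂] at h ⊢
        push_cast at h ⊢
        linear_combination h - 4 * zmod3_three_eq_zero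
    · rw [if_neg hd3]
      apply jac_cexp_of_eq (by ring)
      have hd2 : d % 2 = 1 := Int.odd_iff.mp hdo
      obtain ⟨f, rfl⟩ : ∃ f, d = 4 * f + 1 := ⟨d / 4, by omega⟩
      refine twentyfour_dvd_of_zmod ?_ ?_
      · have h := etaMult_step_S6 (a : ZMod 8) b e f (by
            have h' := zmod_det 8 hdet; push_cast at h'; linear_combination h')
        simp only [etaP₁, etaP₂] at h ⊢
        push_cast
        linear_combination h
      · have h := etaMult_step_S12m3 (a : ZMod 3) b (e + e) (4 * f + 1) (by
            have h' := zmod_det 3 hdet; push_cast at h'; linear_combination h')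
        simp only [etaP₁, etaP₂] at h ⊢
        push_cast at h ⊢
        linear_combination h
  · -- `c` odd, so `c > 0`
    have hc0 : 0 < c := lt_of_le_of_ne hc (by rintro rfl; exact absurd hco (by decide))
    rcases Int.even_or_odd d with hde | hdo
    · -- `d` even: new even branch, `J(d | |-c|) = J(d | |c|)`
      rw [etaMultiplier_of_odd hco, etaMultiplier_of_even hde, Int.natAbs_neg]
      apply jac_cexp_of_eq rfl
      obtain ⟨e, rfl⟩ := hco
      obtain ⟨f, rfl⟩ := hde
      refine twentyfour_dvd_of_zmod ?_ ?_
      · have h := etaMult_step_S4 (a : ZMod 8) b e f (by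
            have h' := zmod_det 8 hdet; push_cast at h'; linear_combination h')
        simp only [etaP₁, etaP₂] at h ⊢
        push_cast
        linear_combination h
      · have h := etaMult_step_S21m3 (a : ZMod 3) b (2 * e + 1) (f + f) (by
            have h' := zmod_det 3 hdet; push_cast at h'; linear_combination h')
        simp only [etaP₁, etaP₂] at h ⊢
        push_cast at h ⊢
        linear_combination h
    · -- `d` odd: new odd branch; reciprocity
      rw [etaMultiplier_of_odd hco, etaMultiplier_of_odd hdo, jacobiSym_neg_left_natAbs _ hdo,
        χ₄_natAbs_of_pos hdo hd, jacobiSym_eq_recipSign_mul hc0 hco hdo]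
      have hc2 : c % 2 = 1 := Int.odd_iff.mp hco
      have hd2 : d % 2 = 1 := Int.odd_iff.mp hdo
      unfold recipSign
      by_cases hc1 : c % 4 = 1
      · by_cases hd3 : d % 4 = 3
        · -- flip
          rw [if_pos hd3, if_neg (by omega)]
          apply jac_cexp_of_eq_neg (by ring)
          obtain ⟨e, rfl⟩ : ∃ e, c = 4 * e + 1 := ⟨c / 4, by omega⟩
          obtain ⟨f, rfl⟩ : ∃ f, d = 4 * f + 3 := ⟨d / 4, by omega⟩
          refine twentyfour_dvd_of_zmod ?_ ?_
          · have h := etaMult_step_S1 (a : ZMod 8) b e f (by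
            have h' := zmod_det 8 hdet; push_cast at h'; linear_combination h')
            simp only [etaP₁] at h ⊢
            push_cast
            linear_combination h
          · have h := etaMult_step_S11m3 (a : ZMod 3) b (4 * e + 1) (4 * f + 3)
              (by
            have h' := zmod_det 3 hdet; push_cast at h'; linear_combination h')
            simp only [etaP₁] at h ⊢
            push_cast at h ⊢
            linear_combination h - 4 * zmod3_three_eq_zero
        · rw [if_neg hd3, if_neg (by omega)]
          apply jac_cexp_of_eq (by ring)
          obtain ⟨e, rfl⟩ : ∃ e, c = 4 * e + 1 := ⟨c / 4, by omega⟩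
          obtain ⟨f, rfl⟩ : ∃ f, d = 4 * f + 1 := ⟨d / 4, by omega⟩
          refine twentyfour_dvd_of_zmod ?_ ?_
          · have h := etaMult_step_S3 (a : ZMod 8) b e f (by
            have h' := zmod_det 8 hdet; push_cast at h'; linear_combination h')
            simp only [etaP₁] at h ⊢
            push_cast
            linear_combination h
          · have h := etaMult_step_S11m3 (a : ZMod 3) b (4 * e + 1) (4 * f + 1)
              (by
            have h' := zmod_det 3 hdet; push_cast at h'; linear_combination h')
            simp only [etaP₁] at h ⊢
            push_cast at h ⊢
            linear_combination h
      · have hc3 : c % 4 = 3 := by omega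
        -- `χ₄(d) ε(c, d) = 1` when `c ≡ 3 (mod 4)`
        have hsign : ((if d % 4 = 3 then -1 else 1 : ℤ) *
            ((if c % 4 = 3 ∧ d % 4 = 3 then -1 else 1) * J(d | c.natAbs))) = J(d | c.natAbs) := by
          by_cases hd3 : d % 4 = 3
          · rw [if_pos hd3, if_pos ⟨hc3, hd3⟩]; ring
          · rw [if_neg hd3, if_neg (fun h ↦ hd3 h.2)]; ring
        apply jac_cexp_of_eq (by exact_mod_cast hsign)
        obtain ⟨e, rfl⟩ : ∃ e, c = 4 * e + 3 := ⟨c / 4, by omega⟩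
        obtain ⟨f, rfl⟩ := hdo
        refine twentyfour_dvd_of_zmod ?_ ?_
        · have h := etaMult_step_S2 (a : ZMod 8) b e f (by
            have h' := zmod_det 8 hdet; push_cast at h'; linear_combination h')
          simp only [etaP₁] at h ⊢
          push_cast
          linear_combination h
        · have h := etaMult_step_S11m3 (a : ZMod 3) b (4 * e + 3) (2 * f + 1)
            (by
            have h' := zmod_det 3 hdet; push_cast at h'; linear_combination h')
          simp only [etaP₁] at h ⊢
          push_cast at h ⊢
          linear_combination h

/-- **Arithmetic of the step `γ ↦ γS`, case `d ≤ 0`** (Knopp, Ch. 4, proof of Thm. 2, case 3):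
for `ad - bc = 1` with `c > 0` and `d ≤ 0`, `v_η(-γS) = e^{πi/4} v_η(γ)` where
`-γS = (-b, a; -d, c)` is the representative of `γS` with positive lower-left entry. [folklore] -/
theorem etaMultiplier_mul_S_of_nonpos {a b c d : ℤ} (hdet : a * d - b * c = 1) (hc : 0 < c)
    (hd : d ≤ 0) :
    etaMultiplier (-b) a (-d) c = etaMultiplier a b c d * cexp (π * I / 4) := by
  have hk : cexp (π * I / 4) = cexp (π * I / 12 * (3 : ℤ)) := by push_cast; congr 1; ring
  rw [hk]
  rcases Int.even_or_odd c with hce | hco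
  · -- `c` even, `d` odd `< 0`: old even branch; new `c' = -d` odd: odd branch, same symbol
    have hdo : Odd d := odd_d_of_even_c hdet hce
    have hdo' : Odd (-d) := odd_neg.mpr hdo
    rw [etaMultiplier_of_even hce, etaMultiplier_of_odd hdo', Int.natAbs_neg]
    apply jac_cexp_of_eq rfl
    obtain ⟨e, rfl⟩ := hce
    obtain ⟨f, rfl⟩ := hdo
    refine twentyfour_dvd_of_zmod ?_ ?_
    · have h := etaMult_step_M6 (a : ZMod 8) b e f (by
        have h' := zmod_det 8 hdet; push_cast at h'; linear_combination h')
      simp only [etaP₁, etaP₂] at h ⊢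
      push_cast
      linear_combination h
    · have h := etaMult_step_M12m3 (a : ZMod 3) b (e + e) (2 * f + 1) (by
        have h' := zmod_det 3 hdet; push_cast at h'; linear_combination h')
      simp only [etaP₁, etaP₂] at h ⊢
      push_cast at h ⊢
      linear_combination h
  · rcases Int.even_or_odd d with hde | hdo
    · -- `c` odd, `d` even `≤ 0`: new `c' = -d` even: even branch, `J(-d | c) = χ₄(c) J(d | c)`
      have hde' : Even (-d) := even_neg.mpr hde
      rw [etaMultiplier_of_odd hco, etaMultiplier_of_even hde', jacobiSym_neg_left_natAbs _ hco,
        χ₄_natAbs_of_pos hco hc]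
      have hc2 : c % 2 = 1 := Int.odd_iff.mp hco
      by_cases hc3 : c % 4 = 3
      · rw [if_pos hc3]
        apply jac_cexp_of_eq_neg (by ring)
        obtain ⟨e, rfl⟩ : ∃ e, c = 4 * e + 3 := ⟨c / 4, by omega⟩
        obtain ⟨f, rfl⟩ := hde
        refine twentyfour_dvd_of_zmod ?_ ?_
        · have h := etaMult_step_M4 (a : ZMod 8) b e f (by
            have h' := zmod_det 8 hdet; push_cast at h'; linear_combination h')
          simp only [etaP₁, etaP₂] at h ⊢
          push_cast
          linear_combination h
        · have h := etaMult_step_M21m3 (a : ZMod 3) b (4 * e + 3) (f + f) (by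
            have h' := zmod_det 3 hdet; push_cast at h'; linear_combination h')
          simp only [etaP₁, etaP₂] at h ⊢
          push_cast at h ⊢
          linear_combination h - 4 * zmod3_three_eq_zero
      · rw [if_neg hc3]
        apply jac_cexp_of_eq (by ring)
        obtain ⟨e, rfl⟩ : ∃ e, c = 4 * e + 1 := ⟨c / 4, by omega⟩
        obtain ⟨f, rfl⟩ := hde
        refine twentyfour_dvd_of_zmod ?_ ?_
        · have h := etaMult_step_M5 (a : ZMod 8) b e f (by
            have h' := zmod_det 8 hdet; push_cast at h'; linear_combination h')
          simp only [etaP₁, etaP₂] at h ⊢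
          push_cast
          linear_combination h
        · have h := etaMult_step_M21m3 (a : ZMod 3) b (4 * e + 1) (f + f) (by
            have h' := zmod_det 3 hdet; push_cast at h'; linear_combination h')
          simp only [etaP₁, etaP₂] at h ⊢
          push_cast at h ⊢
          linear_combination h
    · -- `c` odd, `d` odd `< 0`: new odd branch with symbol `J(c | |d|) = ε(c,d) J(d | c)`
      have hdo' : Odd (-d) := odd_neg.mpr hdo
      rw [etaMultiplier_of_odd hco, etaMultiplier_of_odd hdo', Int.natAbs_neg,
        jacobiSym_eq_recipSign_mul hc hco hdo]
      have hc2 : c % 2 = 1 := Int.odd_iff.mp hco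
      have hd2 : d % 2 = 1 := Int.odd_iff.mp hdo
      unfold recipSign
      by_cases hflip : c % 4 = 3 ∧ d % 4 = 3
      · rw [if_pos hflip]
        apply jac_cexp_of_eq_neg (by ring)
        obtain ⟨e, rfl⟩ : ∃ e, c = 4 * e + 3 := ⟨c / 4, by omega⟩
        obtain ⟨f, rfl⟩ : ∃ f, d = 4 * f + 3 := ⟨d / 4, by omega⟩
        refine twentyfour_dvd_of_zmod ?_ ?_
        · have h := etaMult_step_M1 (a : ZMod 8) b e f (by
            have h' := zmod_det 8 hdet; push_cast at h'; linear_combination h')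
          simp only [etaP₁] at h ⊢
          push_cast
          linear_combination h
        · have h := etaMult_step_M11m3 (a : ZMod 3) b (4 * e + 3) (4 * f + 3) (by
            have h' := zmod_det 3 hdet; push_cast at h'; linear_combination h')
          simp only [etaP₁] at h ⊢
          push_cast at h ⊢
          linear_combination h - 4 * zmod3_three_eq_zero
      · rw [if_neg hflip]
        apply jac_cexp_of_eq (by ring)
        by_cases hc1 : c % 4 = 1
        · obtain ⟨e, rfl⟩ : ∃ e, c = 4 * e + 1 := ⟨c / 4, by omega⟩
          obtain ⟨f, rfl⟩ := hdo
          refine twentyfour_dvd_of_zmod ?_ ?_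
          · have h := etaMult_step_M2 (a : ZMod 8) b e f (by
              have h' := zmod_det 8 hdet; push_cast at h'; linear_combination h')
            simp only [etaP₁] at h ⊢
            push_cast
            linear_combination h
          · have h := etaMult_step_M11m3 (a : ZMod 3) b (4 * e + 1) (2 * f + 1) (by
              have h' := zmod_det 3 hdet; push_cast at h'; linear_combination h')
            simp only [etaP₁] at h ⊢
            push_cast at h ⊢
            linear_combination h
        · have hd1 : d % 4 = 1 := by omega
          obtain ⟨e, rfl⟩ : ∃ e, c = 4 * e + 3 := ⟨c / 4, by omega⟩
          obtain ⟨f, rfl⟩ : ∃ f, d = 4 * f + 1 := ⟨d / 4, by omega⟩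
          refine twentyfour_dvd_of_zmod ?_ ?_
          · have h := etaMult_step_M3 (a : ZMod 8) b e f (by
              have h' := zmod_det 8 hdet; push_cast at h'; linear_combination h')
            simp only [etaP₁] at h ⊢
            push_cast
            linear_combination h
          · have h := etaMult_step_M11m3 (a : ZMod 3) b (4 * e + 3) (4 * f + 1) (by
              have h' := zmod_det 3 hdet; push_cast at h'; linear_combination h')
            simp only [etaP₁] at h ⊢
            push_cast at h ⊢
            linear_combination h

/-! ### The transformation law of `η` under `SL₂(ℤ)` -/

/-- The multiplier `v_η(γ)` of a matrix `γ ∈ SL₂(ℤ)` (meaningful for `γ` normalised to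
`c > 0` or `(c, d) = (0, 1)`). [folklore] -/
def etaMultiplierSL (γ : SL(2, ℤ)) : ℂ := etaMultiplier (γ 0 0) (γ 0 1) (γ 1 0) (γ 1 1)

/-- The normalisation condition `c > 0 ∨ (c = 0 ∧ d > 0)`: exactly one of `±γ` satisfies it.
[folklore] -/
def SLpos (γ : SL(2, ℤ)) : Prop := 0 < γ 1 0 ∨ (γ 1 0 = 0 ∧ 0 < γ 1 1)

/-- `SLpos` is decidable. [folklore] -/
instance (γ : SL(2, ℤ)) : Decidable (SLpos γ) := by unfold SLpos; infer_instance

/-- The representative of `{±γ}` with `c > 0` or `(c, d) = (0, 1)`. [folklore] -/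
def posRep (γ : SL(2, ℤ)) : SL(2, ℤ) := if SLpos γ then γ else -γ

/-- If `c = 0` then `d = ±1`. [folklore] -/
theorem SL2Z_d_of_c_eq_zero (γ : SL(2, ℤ)) (hc : γ 1 0 = 0) : γ 1 1 = 1 ∨ γ 1 1 = -1 := by
  have h := det_entries γ
  rw [hc, mul_zero, sub_zero] at h
  exact Int.eq_one_or_neg_one_of_mul_eq_one' h |>.elim (fun h ↦ Or.inl h.2) (fun h ↦ Or.inr h.2)

/-- Entries of `-γ`. [folklore] -/
theorem SL_neg_apply (γ : SL(2, ℤ)) (i j : Fin 2) : (-γ) i j = -(γ i j) := by simp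

/-- `-γ` is normalised iff `γ` is not. [folklore] -/
theorem SLpos_neg_iff (γ : SL(2, ℤ)) : SLpos (-γ) ↔ ¬ SLpos γ := by
  unfold SLpos
  rw [SL_neg_apply, SL_neg_apply]
  rcases lt_trichotomy (γ 1 0) 0 with hc | hc | hc
  · constructor
    · rintro - (h | ⟨h0, -⟩) <;> omega
    · intro; exact Or.inl (by linarith)
  · rcases SL2Z_d_of_c_eq_zero γ hc with hd | hd <;> simp [hc, hd]
  · constructor
    · rintro (h | ⟨h0, -⟩) <;> omega
    · intro h; exact absurd (Or.inl hc) h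

/-- `posRep γ` is normalised. [folklore] -/
theorem SLpos_posRep (γ : SL(2, ℤ)) : SLpos (posRep γ) := by
  unfold posRep
  by_cases h : SLpos γ
  · rwa [if_pos h]
  · rw [if_neg h]; exact (SLpos_neg_iff γ).mpr h

/-- `posRep (-γ) = posRep γ`. [folklore] -/
theorem posRep_neg (γ : SL(2, ℤ)) : posRep (-γ) = posRep γ := by
  unfold posRep
  by_cases h : SLpos γ
  · rw [if_pos h, if_neg (fun h' ↦ (SLpos_neg_iff γ).mp h' h), neg_neg]
  · rw [if_neg h, if_pos ((SLpos_neg_iff γ).mpr h)]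

/-- `posRep γ = γ` for normalised `γ`. [folklore] -/
theorem posRep_of_SLpos {γ : SL(2, ℤ)} (h : SLpos γ) : posRep γ = γ := if_pos h

/-- `posRep γ` acts like `γ` on `ℍ`. [folklore] -/
theorem posRep_smul (γ : SL(2, ℤ)) (τ : ℍ) : posRep γ • τ = γ • τ := by
  unfold posRep; split_ifs <;> simp

/-- `posRep (γT) = posRep(γ) T`. [folklore] -/
theorem posRep_mul_T (γ : SL(2, ℤ)) : posRep (γ * ModularGroup.T) = posRep γ * ModularGroup.T := by
  obtain ⟨-, -, h10, h11⟩ := coe_mul_T γ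
  have hiff : SLpos (γ * ModularGroup.T) ↔ SLpos γ := by
    unfold SLpos; rw [h10, h11]
    constructor
    · rintro (h | ⟨h0, h1⟩)
      · exact Or.inl h
      · exact Or.inr ⟨h0, by rw [h0, zero_add] at h1; exact h1⟩
    · rintro (h | ⟨h0, h1⟩)
      · exact Or.inl h
      · exact Or.inr ⟨h0, by rw [h0, zero_add]; exact h1⟩
  unfold posRep
  by_cases h : SLpos γ
  · rw [if_pos (hiff.mpr h), if_pos h]
  · rw [if_neg (fun h' ↦ h (hiff.mp h')), if_neg h, neg_mul]

/-- Entries of `γT⁻¹`. [folklore] -/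
theorem coe_mul_T_inv (γ : SL(2, ℤ)) :
    (γ * ModularGroup.T⁻¹) 0 0 = γ 0 0 ∧ (γ * ModularGroup.T⁻¹) 0 1 = γ 0 1 - γ 0 0 ∧
      (γ * ModularGroup.T⁻¹) 1 0 = γ 1 0 ∧ (γ * ModularGroup.T⁻¹) 1 1 = γ 1 1 - γ 1 0 := by
  simp only [Matrix.SpecialLinearGroup.coe_mul, ModularGroup.coe_T_inv, Matrix.mul_apply,
    Fin.sum_univ_two]
  simp
  constructor <;> ring

/-- `posRep (γT⁻¹) = posRep(γ) T⁻¹`. [folklore] -/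
theorem posRep_mul_T_inv (γ : SL(2, ℤ)) :
    posRep (γ * ModularGroup.T⁻¹) = posRep γ * ModularGroup.T⁻¹ := by
  obtain ⟨-, -, h10, h11⟩ := coe_mul_T_inv γ
  have hiff : SLpos (γ * ModularGroup.T⁻¹) ↔ SLpos γ := by
    unfold SLpos; rw [h10, h11]
    constructor
    · rintro (h | ⟨h0, h1⟩)
      · exact Or.inl h
      · exact Or.inr ⟨h0, by rw [h0, sub_zero] at h1; exact h1⟩
    · rintro (h | ⟨h0, h1⟩)
      · exact Or.inl h
      · exact Or.inr ⟨h0, by rw [h0, sub_zero]; exact h1⟩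
  unfold posRep
  by_cases h : SLpos γ
  · rw [if_pos (hiff.mpr h), if_pos h]
  · rw [if_neg (fun h' ↦ h (hiff.mp h')), if_neg h, neg_mul]

/-- `S⁻¹ = -S` in `SL₂(ℤ)`. [folklore] -/
theorem modular_S_inv_eq_neg : (ModularGroup.S : SL(2, ℤ))⁻¹ = -ModularGroup.S := by
  ext i j
  fin_cases i <;> fin_cases j <;>
    simp [ModularGroup.S, Matrix.SpecialLinearGroup.coe_inv, Matrix.adjugate_fin_two]

/-- The transformation law at a single matrix, as a proposition: for all `τ ∈ ℍ`,
`η(γτ) = v_η(γ) √(cτ + d) η(τ)`. [folklore] -/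
def EtaTransfAt (γ : SL(2, ℤ)) : Prop :=
  ∀ τ : ℍ, η (↑(γ • τ)) =
    etaMultiplierSL γ * Complex.sqrt ((γ 1 0 : ℂ) * τ + γ 1 1) * η τ

/-- `e^{2πi/24} = e^{πi/12}`. [folklore] -/
theorem cexp_two_pi_I_div_24 : cexp (2 * π * I / 24) = cexp (π * I / 12) := by
  congr 1; ring

/-- **Step `T`** of the induction: the law for `A` normalised implies the law for `AT`.
[folklore] -/
theorem etaTransfAt_mul_T {A : SL(2, ℤ)} (hA : SLpos A) (h : EtaTransfAt A) :
    EtaTransfAt (A * ModularGroup.T) := by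
  intro τ
  obtain ⟨h00, h01, h10, h11⟩ := coe_mul_T A
  have hpos : 0 < A 1 0 ∨ (A 1 0 = 0 ∧ A 1 1 = 1) := by
    rcases hA with h | ⟨h0, h1⟩
    · exact Or.inl h
    · rcases SL2Z_d_of_c_eq_zero A h0 with hd | hd
      · exact Or.inr ⟨h0, hd⟩
      · omega
  rw [etaMultiplierSL, h00, h01, h10, h11, etaMultiplier_mul_T (det_entries A) hpos, mul_smul,
    h (ModularGroup.T • τ)]
  have hT : ((ModularGroup.T • τ : ℍ) : ℂ) = (τ : ℂ) + 1 := by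
    rw [modular_T_smul, coe_vadd]; push_cast; ring
  rw [hT, eta_add_one, cexp_two_pi_I_div_24, etaMultiplierSL]
  push_cast
  ring_nf

/-- **Step `T⁻¹`** of the induction. [folklore] -/
theorem etaTransfAt_mul_T_inv {A : SL(2, ℤ)} (hA : SLpos A) (h : EtaTransfAt A) :
    EtaTransfAt (A * ModularGroup.T⁻¹) := by
  intro τ
  obtain ⟨h00, h01, h10, h11⟩ := coe_mul_T_inv A
  have hpos : 0 < A 1 0 ∨ (A 1 0 = 0 ∧ A 1 1 - A 1 0 = 1) := by
    rcases hA with h | ⟨h0, h1⟩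
    · exact Or.inl h
    · rcases SL2Z_d_of_c_eq_zero A h0 with hd | hd
      · exact Or.inr ⟨h0, by rw [hd, h0]; norm_num⟩
      · omega
  -- `v(A) = v(AT⁻¹) e^{πi/12}`
  have hmul := etaMultiplier_mul_T (a := A 0 0) (b := A 0 1 - A 0 0) (c := A 1 0)
    (d := A 1 1 - A 1 0) (by linear_combination det_entries A) hpos
  rw [show A 0 0 + (A 0 1 - A 0 0) = A 0 1 by ring, show A 1 0 + (A 1 1 - A 1 0) = A 1 1 by ring]
    at hmul
  have hT : ((ModularGroup.T⁻¹ • τ : ℍ) : ℂ) = (τ : ℂ) - 1 := by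
    have := modular_T_zpow_smul τ (-1)
    simp only [zpow_neg, zpow_one] at this
    rw [this, coe_vadd]; push_cast; ring
  have heta : η ((τ : ℂ) - 1) = (cexp (π * I / 12))⁻¹ * η τ := by
    have := eta_add_one ((τ : ℂ) - 1)
    rw [sub_add_cancel, cexp_two_pi_I_div_24] at this
    rw [this, ← mul_assoc, inv_mul_cancel₀ (Complex.exp_ne_zero _), one_mul]
  rw [etaMultiplierSL, h00, h01, h10, h11, mul_smul, h (ModularGroup.T⁻¹ • τ), hT, heta,
    etaMultiplierSL, hmul]
  field_simp
  push_cast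
  ring_nf

/-- `η(-1/τ) = (√i)⁻¹ √τ η(τ)` (Mathlib `eta_comp_eq_csqrt_I_inv`), at `S • τ`. [folklore] -/
theorem eta_S_smul (τ : ℍ) :
    η (↑(ModularGroup.S • τ)) = cexp (-(π * I / 4)) * Complex.sqrt τ * η τ := by
  have hS : ((ModularGroup.S • τ : ℍ) : ℂ) = -1 / (τ : ℂ) := by
    rw [modular_S_smul]; simp [neg_div, inv_neg]
  rw [hS, ← csqrt_I_inv, mul_assoc]
  simpa using eta_comp_eq_csqrt_I_inv τ.2

/-- **Step `S`** of the induction: the law for `A` normalised implies the law for the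
normalised representative of `AS` (Knopp, Ch. 4, proof of Thm. 2, case 3, with the branch
relation (2)). [folklore] -/
theorem etaTransfAt_posRep_mul_S {A : SL(2, ℤ)} (hA : SLpos A) (h : EtaTransfAt A) :
    EtaTransfAt (posRep (A * ModularGroup.S)) := by
  intro τ
  obtain ⟨h00, h01, h10, h11⟩ := coe_mul_S A
  have hdet := det_entries A
  have hc0 : 0 ≤ A 1 0 := by
    rcases hA with h | ⟨h0, -⟩
    · exact h.le
    · exact h0.ge
  rw [posRep_smul, mul_smul, h (ModularGroup.S • τ), eta_S_smul]
  have hSc : ((ModularGroup.S • τ : ℍ) : ℂ) = -1 / (τ : ℂ) := by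
    rw [modular_S_smul]; simp [neg_div, inv_neg]
  rw [hSc]
  by_cases hd : 0 < A 1 1
  · -- `d > 0`: the representative is `AS = (b, -a; d, -c)` itself
    have hpos : SLpos (A * ModularGroup.S) := Or.inl (by rw [h10]; exact hd)
    rw [posRep_of_SLpos hpos]
    simp only [etaMultiplierSL, h00, h01, h10, h11]
    rw [etaMultiplier_mul_S_of_pos hdet hc0 hd]
    have hbr := csqrt_mul_csqrt_of_pos τ (c := (A 1 0 : ℝ)) (d := (A 1 1 : ℝ))
      (by exact_mod_cast hc0) (by exact_mod_cast hd)
    push_cast at hbr ⊢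
    rw [show (A 1 0 : ℂ) * (-1 / (τ : ℂ)) + A 1 1 = -(A 1 0 : ℂ) / τ + A 1 1 by ring]
    calc etaMultiplier (A 0 0) (A 0 1) (A 1 0) (A 1 1) *
          Complex.sqrt (-(A 1 0 : ℂ) / τ + A 1 1) *
          (cexp (-(π * I / 4)) * Complex.sqrt τ * η τ)
        = etaMultiplier (A 0 0) (A 0 1) (A 1 0) (A 1 1) * cexp (-(π * I / 4)) *
          (Complex.sqrt (-(A 1 0 : ℂ) / τ + A 1 1) * Complex.sqrt τ) * η τ := by ring
      _ = _ := by rw [hbr]; ring_nf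
  · -- `d ≤ 0`, so `c > 0`: the representative is `-(AS) = (-b, a; -d, c)`
    push Not at hd
    have hc : 0 < A 1 0 := by
      rcases hA with h | ⟨h0, h1⟩
      · exact h
      · exact absurd h1 (not_lt.mpr hd)
    have hnpos : ¬ SLpos (A * ModularGroup.S) := by
      unfold SLpos; rw [h10, h11]; push Not
      exact ⟨hd, fun _ ↦ by linarith⟩
    rw [show posRep (A * ModularGroup.S) = -(A * ModularGroup.S) from if_neg hnpos]
    simp only [etaMultiplierSL, SL_neg_apply, h00, h01, h10, h11, neg_neg]
    rw [etaMultiplier_mul_S_of_nonpos hdet hc hd]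
    have hbr := csqrt_mul_csqrt_of_nonpos τ (c := (A 1 0 : ℝ)) (d := (A 1 1 : ℝ))
      (by exact_mod_cast hc) (by exact_mod_cast hd)
    push_cast at hbr ⊢
    rw [show (A 1 0 : ℂ) * (-1 / (τ : ℂ)) + A 1 1 = -(A 1 0 : ℂ) / τ + A 1 1 by ring]
    have hI : cexp (π * I / 4) = cexp (-(π * I / 4)) * I := by
      have h2 : cexp ((π / 2) * I) = I := Complex.exp_pi_div_two_mul_I
      rw [show cexp (π * I / 4) = cexp (-(π * I / 4) + (π / 2) * I) by congr 1; ring,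
        Complex.exp_add, h2]
    calc etaMultiplier (A 0 0) (A 0 1) (A 1 0) (A 1 1) *
          Complex.sqrt (-(A 1 0 : ℂ) / τ + A 1 1) *
          (cexp (-(π * I / 4)) * Complex.sqrt τ * η τ)
        = etaMultiplier (A 0 0) (A 0 1) (A 1 0) (A 1 1) * cexp (-(π * I / 4)) *
          (Complex.sqrt (-(A 1 0 : ℂ) / τ + A 1 1) * Complex.sqrt τ) * η τ := by ring
      _ = _ := by rw [hbr, hI]; ring_nf

/-- `posRep (posRep(x) y) = posRep (x y)`. [folklore] -/
theorem posRep_posRep_mul (x y : SL(2, ℤ)) : posRep (posRep x * y) = posRep (x * y) := by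
  by_cases h : SLpos x
  · rw [posRep_of_SLpos h]
  · rw [show posRep x = -x from if_neg h, neg_mul, posRep_neg]

/-- The law for all normalised representatives, by induction over words in `S`, `T`.
[folklore] -/
theorem etaTransfAt_posRep (γ : SL(2, ℤ)) : EtaTransfAt (posRep γ) := by
  have hγ : γ ∈ Subgroup.closure ({ModularGroup.S, ModularGroup.T} : Set SL(2, ℤ)) := by
    rw [SpecialLinearGroup.SL2Z_generators]; trivial
  induction hγ using Subgroup.closure_induction_right with
  | one =>
    have h1 : SLpos (1 : SL(2, ℤ)) := Or.inr ⟨by simp, by simp⟩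
    rw [posRep_of_SLpos h1]
    intro τ
    simp [etaMultiplierSL, etaMultiplier_one]
  | mul_right x hx y hy ih =>
    rcases hy with rfl | rfl
    · -- `y = S`
      rw [← posRep_posRep_mul]
      exact etaTransfAt_posRep_mul_S (SLpos_posRep x) ih
    · -- `y = T`
      rw [posRep_mul_T]
      exact etaTransfAt_mul_T (SLpos_posRep x) ih
  | mul_inv_cancel x hx y hy ih =>
    rcases hy with rfl | rfl
    · -- `y = S`: `x S⁻¹ = -(x S)`
      rw [modular_S_inv_eq_neg, mul_neg, posRep_neg, ← posRep_posRep_mul]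
      exact etaTransfAt_posRep_mul_S (SLpos_posRep x) ih
    · -- `y = T`
      rw [posRep_mul_T_inv]
      exact etaTransfAt_mul_T_inv (SLpos_posRep x) ih

/-- **The transformation law of the Dedekind eta function** (Petersson's formula; Knopp, Ch. 4,
Thm. 2): for `γ = (a b; c d) ∈ SL₂(ℤ)` with `c > 0`, or `c = 0` and `d > 0`, and `τ ∈ ℍ`,
`η(γτ) = v_η(γ) √(cτ + d) η(τ)` with the principal square root and
`v_η(γ) = (d/c) e^{πi[(a+d)c - bd(c²-1) - 3c]/12}` (`c` odd),
`v_η(γ) = (c/|d|) e^{πi[(a+d)c - bd(c²-1) + 3d - 3 - 3cd]/12}` (`c` even).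
[cite: Knopp1970, Ch. 4, Thm. 2] -/
theorem eta_SL2_smul (γ : SL(2, ℤ)) (hγ : SLpos γ) (τ : ℍ) :
    η (↑(γ • τ)) = etaMultiplierSL γ * Complex.sqrt ((γ 1 0 : ℂ) * τ + γ 1 1) * η τ := by
  have := etaTransfAt_posRep γ
  rw [posRep_of_SLpos hγ] at this
  exact this τ

/-! ### Consequences -/

/-- In `SL₂(ℤ)`, `gcd(d, c) = 1`. [folklore] -/
theorem SL2Z_gcd_eq_one {a b c d : ℤ} (hdet : a * d - b * c = 1) : Int.gcd d c = 1 := by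
  rw [← Int.isCoprime_iff_gcd_eq_one]
  exact ⟨a, -b, by linear_combination hdet⟩

/-- **`|v_η(a b; c d)| = 1`** for any integers with `ad - bc = 1` (no normalisation needed): the
Jacobi symbol in Petersson's formula is `±1` since `gcd(c, d) = 1`. [folklore] -/
theorem norm_etaMultiplier {a b c d : ℤ} (hdet : a * d - b * c = 1) :
    ‖etaMultiplier a b c d‖ = 1 := by
  have hJ : ∀ {x : ℤ} {n : ℕ}, x.gcd n = 1 → ‖((J(x | n) : ℤ) : ℂ)‖ = 1 := by
    intro x n h
    rcases jacobiSym.eq_one_or_neg_one h with h1 | h1 <;> simp [h1]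
  have hexp : ∀ P : ℤ, ‖cexp (π * I / 12 * P)‖ = 1 := fun P ↦ by
    rw [Complex.norm_exp]
    simp
  have hg := SL2Z_gcd_eq_one hdet
  unfold etaMultiplier
  split_ifs with hc
  · rw [norm_mul, hexp, hJ, one_mul]
    rw [Int.gcd] at hg ⊢
    simpa [Int.natAbs_abs] using hg
  · rw [norm_mul, hexp, hJ, one_mul]
    rw [Int.gcd] at hg ⊢
    simpa [Int.natAbs_abs, Nat.gcd_comm] using hg

/-- **Consistency of the two formulas** (Knopp, Ch. 4, the case `c`, `d` both odd of Thm. 2):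
for `c > 0` and `d` odd, `v_η` is also given by the second formula,
`v_η(γ) = (c/|d|) e^{πi[(a+d)c - bd(c²-1) + 3d - 3 - 3cd]/12}`; this is the form used in
Newman's `η`-quotient criterion. [folklore] -/
theorem etaMultiplier_of_odd_d {a b c d : ℤ} (hc : 0 < c) (hd : Odd d) :
    etaMultiplier a b c d = (J(c | d.natAbs) : ℂ) * cexp (π * I / 12 * etaP₂ a b c d) := by
  rcases Int.even_or_odd c with hce | hco
  · exact etaMultiplier_of_even hce
  rw [etaMultiplier_of_odd hco, ← mul_one (cexp (π * I / 12 * (etaP₂ a b c d : ℤ))),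
    show (1 : ℂ) = cexp (π * I / 12 * (0 : ℤ)) by simp, ← mul_assoc]
  have hrel : J(d | c.natAbs) = recipSign c d * J(c | d.natAbs) := by
    rw [jacobiSym_eq_recipSign_mul hc hco hd, ← mul_assoc, recipSign_mul_self, one_mul]
  have hdiff : etaP₁ a b c d - etaP₂ a b c d = 3 * (c - 1) * (d - 1) := by
    unfold etaP₁ etaP₂; ring
  have hc2 : c % 2 = 1 := Int.odd_iff.mp hco
  have hd2 : d % 2 = 1 := Int.odd_iff.mp hd
  unfold recipSign at hrel
  by_cases hflip : c % 4 = 3 ∧ d % 4 = 3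
  · rw [if_pos hflip, neg_one_mul] at hrel
    apply jac_cexp_of_eq_neg hrel
    obtain ⟨e, rfl⟩ : ∃ e, c = 4 * e + 3 := ⟨c / 4, by omega⟩
    obtain ⟨f, rfl⟩ : ∃ f, d = 4 * f + 3 := ⟨d / 4, by omega⟩
    exact ⟨2 * e * f + e + f, by linear_combination hdiff⟩
  · rw [if_neg hflip, one_mul] at hrel
    apply jac_cexp_of_eq hrel
    rw [add_zero]
    rcases (by omega : c % 4 = 1 ∨ d % 4 = 1) with h1 | h1
    · obtain ⟨e, rfl⟩ : ∃ e, c = 4 * e + 1 := ⟨c / 4, by omega⟩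
      obtain ⟨f, rfl⟩ := hd
      exact ⟨e * f, by linear_combination hdiff⟩
    · obtain ⟨f, rfl⟩ : ∃ f, d = 4 * f + 1 := ⟨d / 4, by omega⟩
      obtain ⟨e, rfl⟩ := hco
      exact ⟨e * f, by linear_combination hdiff⟩

/-- `v_η(T^n) = e^{πi n/12}` (`c = 0`, `d = 1`). [folklore] -/
theorem etaMultiplier_T_zpow (n : ℤ) : etaMultiplier 1 n 0 1 = cexp (π * I / 12 * n) := by
  rw [etaMultiplier_of_even (by decide)]
  simp [etaP₂]

/-- `v_η(S) = e^{-πi/4}`. [folklore] -/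
theorem etaMultiplier_S : etaMultiplier 0 (-1) 1 0 = cexp (-(π * I / 4)) := by
  rw [etaMultiplier_of_odd (by decide)]
  simp [etaP₁]
  congr 1; ring

end Literature.NumberTheory.EllipticCurves.ModularForms
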